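import Summits.HodgeConjecture.HodgeConjecture.Theorems.EndoscopicMiddleDegreeOrthogonalEnvelopedRationalRelations
import Summits.HodgeConjecture.HodgeConjecture.Theorems.EndoscopicMiddleDegreeOrthogonalEnvelopedRatSpannedInf
import Literature.AlgebraicGeometry.ShimuraVarieties.HeckeCorrespondenceAction
import Literature.AlgebraicGeometry.HodgeTheory.ComplexGysinHodgeType
import Literature.AlgebraicGeometry.HodgeTheory.ComplexConjugationHolds
import Literature.AlgebraicGeometry.HodgeTheory.HodgeFiltrationModelsReductionProofs
import Literature.AlgebraicGeometry.HodgeTheory.HodgeTypeConjugation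
import Literature.AlgebraicGeometry.HodgeTheory.RationalClassesRingChange
import Literature.AlgebraicGeometry.HodgeTheory.SupportedClassesRationalProofs
import Literature.AlgebraicGeometry.HodgeTheory.VanishingCohomologyNontrivialProofs

/-!
# ℚ-descent of the centre of the Hecke algebra
# (crux `EndoscopicMiddleDegree.OrthogonalEnveloped`, stmt-HodgeConjecture-14300; line `middle-involution-purity`,
# second lead lineage; closes the registered stub `stub_centreDescent`)

For a compact ball quotient `X` with datum `D : UnitaryBallQuotientDatum p X` let
`𝓗 = Algebra.adjoin ℂ (range (D.heckeCorrespondenceAction k))` be the Hecke algebra on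
`H = Hᵏ(X(ℂ); ℂ)` (`X` smooth projective). Its generators `T_g` preserve rational classes
(`isRationalClass_heckeCorrespondenceAction`), so `𝓗` is the ℂ-span of finitely many
RATIONAL-PRESERVING monomials (`descent_exists_spanning_monomials`), and `H` has a finite rational
spanning family (`descent_exists_rational_spanning`). MAIN RESULT `stub_centreDescent`: every
CENTRAL element `z ∈ 𝓗` is a ℂ-combination of rational-preserving central elements of `𝓗` — the
centrality equations `Σ_a c_a (μ_a μ_b - μ_b μ_a)(x_d) = 0` are finitely many ℚ-linear systems whose
complex solution spaces are ℚ-spanned (landed `stub_rationalRelations`, p98208) and so is their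
intersection (landed `stub_ratSpannedInf`, p98217; `descent_ratSpanned_finset_inf`). Consumed by the
ℚ-descent lemma `rationalBlockDescent` (file `…RationalBlockDescent`).

## References
* [BergeronMillsonMoeglin2016Balls] N. Bergeron, J. Millson, C. Moeglin, arXiv:1306.1515, Part 2 §1.9 (Hecke
  operators act on `Hᵏ(S(Γ); ℚ)`; ℚ-Hecke-isotypic pieces).
* [VoisinHodgeI2002] C. Voisin, Hodge Theory and Complex Algebraic Geometry I, §7.1.1.
* [HatcherAT2002] A. Hatcher, Algebraic Topology, §3.1 p. 198.
-/

noncomputable section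

-- The line namespace `Summit.<P>.<Sub>.Cruxes.…` repeats `HodgeConjecture` (single-conjunct summit).
set_option linter.dupNamespace false

namespace Summit.HodgeConjecture.HodgeConjecture.Cruxes.OrthogonalEnveloped.MiddleInvolutionPurity

open scoped BigOperators
open CategoryTheory
open Literature.AlgebraicGeometry.Motives (SchemeOver ComplexPoints IsSmoothProjective)
open Literature.AlgebraicGeometry.HodgeTheory
open Literature.AlgebraicGeometry.ShimuraVarieties
open Literature.AlgebraicTopology.SingularHomology

/-! ## The ℚ-descent lemma: helpers -/

section Descent

variable {k : ℕ} {X : SchemeOver ℂ}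

/-- Rational-preserving operators: `ℚ`-combinations of rational-preserving operators are
rational-preserving. [cite: HatcherAT2002, §3.1 p. 198] -/
theorem descent_rp_sum_smul {ι : Type*} (s : Finset ι) {T : ι → Module.End ℂ (complexBetti X k)}
    (hT : ∀ i, ∀ β, IsRationalClass β → IsRationalClass (T i β)) (q : ι → ℚ) :
    ∀ β, IsRationalClass β → IsRationalClass ((∑ i ∈ s, ((q i : ℚ) : ℂ) • T i) β) := by
  intro β hβ
  rw [LinearMap.sum_apply]
  simp only [LinearMap.smul_apply]
  exact IsRationalClass.sum_smul s (fun i ↦ hT i β hβ) q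

/-- Products of rational-preserving operators are rational-preserving. [folklore] -/
theorem descent_rp_mul {S T : Module.End ℂ (complexBetti X k)}
    (hS : ∀ β, IsRationalClass β → IsRationalClass (S β))
    (hT : ∀ β, IsRationalClass β → IsRationalClass (T β)) :
    ∀ β, IsRationalClass β → IsRationalClass ((S * T) β) :=
  fun β hβ ↦ hS _ (hT β hβ)

/-- Differences of rational classes are rational. [cite: HatcherAT2002, §3.1 p. 198] -/
theorem descent_isRationalClass_sub {a b : complexBetti X k} (ha : IsRationalClass a)
    (hb : IsRationalClass b) : IsRationalClass (a - b) := by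
  have h := ha.add (hb.smul (-1))
  simpa [sub_eq_add_neg] using h

/-- The monomials in the Hecke operators are rational-preserving (the generators are,
`isRationalClass_heckeCorrespondenceAction`; closure under products). [cite: BergeronMillsonMoeglin2016Balls, Part 2 §1.9] -/
theorem descent_rp_of_mem_closure {p : ℕ} (D : UnitaryBallQuotientDatum p X)
    {T : Module.End ℂ (complexBetti X k)}
    (hT : T ∈ Submonoid.closure (Set.range (D.heckeCorrespondenceAction k))) :
    ∀ β, IsRationalClass β → IsRationalClass (T β) := by
  induction hT using Submonoid.closure_induction with
  | mem T hT =>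
    obtain ⟨g, rfl⟩ := hT
    exact fun β hβ ↦ D.isRationalClass_heckeCorrespondenceAction k g hβ
  | one => exact fun β hβ ↦ hβ
  | mul S T _ _ ihS ihT => exact descent_rp_mul ihS ihT

/-- **A finite rational-preserving spanning family of the Hecke algebra**: `𝓗 = adjoin ℂ (range T_g)`
is the ℂ-span of the monomials in the `T_g` (`Algebra.adjoin_eq_span`), a finite-dimensional space
(`X` smooth projective), so finitely many monomials span it. [cite: BergeronMillsonMoeglin2016Balls, Part 2 §1.9] -/
theorem descent_exists_spanning_monomials {n p : ℕ} (hX : IsSmoothProjective n X)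
    (D : UnitaryBallQuotientDatum p X) :
    ∃ (P : ℕ) (μ : Fin P → Module.End ℂ (complexBetti X k)),
      (∀ a, μ a ∈ Algebra.adjoin ℂ (Set.range (D.heckeCorrespondenceAction k))) ∧
      (∀ a, ∀ β, IsRationalClass β → IsRationalClass (μ a β)) ∧
      Submodule.span ℂ (Set.range μ) =
        Subalgebra.toSubmodule (Algebra.adjoin ℂ (Set.range (D.heckeCorrespondenceAction k))) := by
  classical
  haveI := finite_complexBetti hX k
  set M : Set (Module.End ℂ (complexBetti X k)) :=
    (Submonoid.closure (Set.range (D.heckeCorrespondenceAction k)) : Set (Module.End ℂ (complexBetti X k)))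
  obtain ⟨b, hbM, hbspan, hbli⟩ := exists_linearIndependent ℂ M
  have hbfin : b.Finite := hbli.set_finite_of_isNoetherian
  haveI : Fintype b := hbfin.fintype
  let e : b ≃ Fin (Fintype.card b) := Fintype.equivFin b
  refine ⟨Fintype.card b, fun a ↦ (e.symm a : Module.End ℂ (complexBetti X k)), ?_, ?_, ?_⟩
  · intro a
    have hmem : ((e.symm a : b) : Module.End ℂ (complexBetti X k)) ∈ M := hbM (e.symm a).2
    exact (Submonoid.closure_le (S := (Algebra.adjoin ℂ
      (Set.range (D.heckeCorrespondenceAction k))).toSubmonoid)).2 Algebra.subset_adjoin hmem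
  · intro a
    exact descent_rp_of_mem_closure D (hbM (e.symm a).2)
  · have hrange : Set.range (fun a ↦ ((e.symm a : b) : Module.End ℂ (complexBetti X k))) = b := by
      ext T
      constructor
      · rintro ⟨a, rfl⟩
        exact (e.symm a).2
      · intro hT
        exact ⟨e ⟨T, hT⟩, by simp⟩
    rw [hrange, hbspan, Algebra.adjoin_eq_span]

/-- **A finite rational spanning family of `Hᵏ(X(ℂ); ℂ)`** (`X` smooth projective: the rational
classes span, `span_isRationalClass_eq_top_of_isSmoothProjective_holds`, and the space is
finite-dimensional). [cite: VoisinHodgeI2002, §7.1.1] -/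
theorem descent_exists_rational_spanning {n : ℕ} (hX : IsSmoothProjective n X) :
    ∃ (Q : ℕ) (x : Fin Q → complexBetti X k), (∀ d, IsRationalClass (x d)) ∧
      Submodule.span ℂ (Set.range x) = ⊤ := by
  classical
  haveI := finite_complexBetti hX k
  obtain ⟨b, hbM, hbspan, hbli⟩ :=
    exists_linearIndependent ℂ {c : complexBetti X k | IsRationalClass c}
  have hbfin : b.Finite := hbli.set_finite_of_isNoetherian
  haveI : Fintype b := hbfin.fintype
  let e : b ≃ Fin (Fintype.card b) := Fintype.equivFin b
  refine ⟨Fintype.card b, fun d ↦ (e.symm d : complexBetti X k), fun d ↦ hbM (e.symm d).2, ?_⟩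
  have hrange : Set.range (fun d ↦ ((e.symm d : b) : complexBetti X k)) = b := by
    ext c
    constructor
    · rintro ⟨d, rfl⟩
      exact (e.symm d).2
    · intro hc
      exact ⟨e ⟨c, hc⟩, by simp⟩
  rw [hrange, hbspan, span_isRationalClass_eq_top_of_isSmoothProjective_holds n X hX k]


/-! ### ℚ-spanned subspaces of `ℂ^P` -/

/-- `ℂ^P` itself is ℚ-spanned (the standard basis vectors are rational). [folklore] -/
theorem descent_ratSpanned_top (P : ℕ) :
    (⊤ : Submodule ℂ (Fin P → ℂ)) ≤ Submodule.span ℂ {c : Fin P → ℂ |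
      c ∈ (⊤ : Submodule ℂ (Fin P → ℂ)) ∧ ∃ q : Fin P → ℚ, c = fun i ↦ (q i : ℂ)} := by
  classical
  intro c _
  rw [pi_eq_sum_univ c]
  refine Submodule.sum_mem _ fun a _ ↦ Submodule.smul_mem _ _ (Submodule.subset_span ⟨Submodule.mem_top, ?_⟩)
  refine ⟨fun j ↦ if a = j then 1 else 0, ?_⟩
  funext j
  by_cases h : a = j
  · simp [h]
  · simp [h]

/-- Finite intersections of ℚ-spanned subspaces of `ℂ^P` are ℚ-spanned (`stub_ratSpannedInf`,
by induction). [folklore] -/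
theorem descent_ratSpanned_finset_inf {P : ℕ} {ι : Type*} (s : Finset ι)
    (W : ι → Submodule ℂ (Fin P → ℂ))
    (hW : ∀ i ∈ s, W i ≤ Submodule.span ℂ {c : Fin P → ℂ | c ∈ W i ∧ ∃ q : Fin P → ℚ, c = fun i ↦ (q i : ℂ)}) :
    s.inf W ≤ Submodule.span ℂ {c : Fin P → ℂ | c ∈ s.inf W ∧ ∃ q : Fin P → ℚ, c = fun i ↦ (q i : ℂ)} := by
  classical
  induction s using Finset.induction_on with
  | empty =>
    rw [Finset.inf_empty]
    exact descent_ratSpanned_top P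
  | insert a s ha ih =>
    rw [Finset.inf_insert]
    exact stub_ratSpannedInf P (W a) (s.inf W) (hW a (Finset.mem_insert_self a s))
      (ih fun i hi ↦ hW i (Finset.mem_insert_of_mem hi))

/-! ### S1 — ℚ-descent of the centre of the Hecke algebra -/

/-- **The centre of the Hecke algebra is ℚ-spanned**: a central element `z` of
`𝓗 = adjoin ℂ (range T_g)` is a ℂ-combination of RATIONAL-PRESERVING central elements of `𝓗`.
Proof: write `z = Σ_a c_a μ_a` over a finite rational-preserving spanning family of monomials
(`descent_exists_spanning_monomials`); centrality is the finite system of ℚ-linear equations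
`Σ_a c_a (μ_a μ_b - μ_b μ_a)(x_d) = 0` over a finite rational spanning family `(x_d)` of `H`
(`descent_exists_rational_spanning`), whose complex solution space is ℚ-spanned
(`stub_rationalRelations` for each equation, `stub_ratSpannedInf` for the intersection); every
rational solution `q` gives the rational-preserving central element `Σ_a q_a μ_a`.
[cite: BergeronMillsonMoeglin2016Balls, Part 2 §1.9] -/
theorem descent_center {n p : ℕ} (hX : IsSmoothProjective n X) (D : UnitaryBallQuotientDatum p X)
    {z : Module.End ℂ (complexBetti X k)}
    (hz1 : z ∈ Algebra.adjoin ℂ (Set.range (D.heckeCorrespondenceAction k)))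
    (hz3 : ∀ T ∈ Algebra.adjoin ℂ (Set.range (D.heckeCorrespondenceAction k)), T * z = z * T) :
    ∃ (I : ℕ) (r : Fin I → Module.End ℂ (complexBetti X k)) (cz : Fin I → ℂ),
      (∀ i, r i ∈ Algebra.adjoin ℂ (Set.range (D.heckeCorrespondenceAction k))) ∧
      (∀ i, ∀ T ∈ Algebra.adjoin ℂ (Set.range (D.heckeCorrespondenceAction k)), T * r i = r i * T) ∧
      (∀ i, ∀ β, IsRationalClass β → IsRationalClass (r i β)) ∧
      z = ∑ i, cz i • r i := by
  classical
  obtain ⟨P, μ, hμA, hμrp, hμspan⟩ := descent_exists_spanning_monomials (k := k) hX D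
  obtain ⟨Q, x, hxrat, hxspan⟩ := descent_exists_rational_spanning (k := k) hX
  -- coefficients of `z` on the spanning family
  have hzspan : z ∈ Submodule.span ℂ (Set.range μ) := by
    rw [hμspan]; exact hz1
  obtain ⟨c, hc⟩ := (Submodule.mem_span_range_iff_exists_fun ℂ).1 hzspan
  -- the rational constraint vectors and their solution spaces
  let w : Fin P × Fin Q → Fin P → complexBetti X k :=
    fun π a ↦ (μ a * μ π.1 - μ π.1 * μ a) (x π.2)
  have hwrat : ∀ π a, IsRationalClass (w π a) := fun π a ↦
    descent_isRationalClass_sub (hμrp a _ (hμrp π.1 _ (hxrat π.2)))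
      (hμrp π.1 _ (hμrp a _ (hxrat π.2)))
  let S : Fin P × Fin Q → Submodule ℂ (Fin P → ℂ) :=
    fun π ↦ LinearMap.ker (Fintype.linearCombination ℂ (w π))
  have hSmem : ∀ π (c' : Fin P → ℂ), c' ∈ S π ↔ ∑ a, c' a • w π a = 0 := fun π c' ↦ by
    simp only [S, LinearMap.mem_ker, Fintype.linearCombination_apply]
  have hSrat : ∀ π ∈ (Finset.univ : Finset (Fin P × Fin Q)), S π ≤ Submodule.span ℂ
      {c' : Fin P → ℂ | c' ∈ S π ∧ ∃ q : Fin P → ℚ, c' = fun i ↦ (q i : ℂ)} := by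
    intro π _ c' hc'
    have h := stub_rationalRelations X k P (w π) (hwrat π) c' ((hSmem π c').1 hc')
    refine Submodule.span_mono ?_ h
    rintro c'' ⟨hq, hrel⟩
    exact ⟨(hSmem π c'').2 hrel, hq⟩
  -- the commutator identity `Σ_a c'_a (μ_a μ_b - μ_b μ_a) = (Σ c'_a μ_a) μ_b - μ_b (Σ c'_a μ_a)`
  have hcommutator : ∀ (c' : Fin P → ℂ) (b : Fin P),
      ∑ a, c' a • (μ a * μ b - μ b * μ a) = (∑ a, c' a • μ a) * μ b - μ b * ∑ a, c' a • μ a := by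
    intro c' b
    rw [Finset.sum_mul, Finset.mul_sum, ← Finset.sum_sub_distrib]
    refine Finset.sum_congr rfl fun a _ ↦ ?_
    rw [smul_sub, smul_mul_assoc, mul_smul_comm]
  -- `c` solves every constraint (centrality of `z`)
  have hcS : c ∈ (Finset.univ : Finset (Fin P × Fin Q)).inf S := by
    refine (Submodule.mem_finsetInf).2 fun π _ ↦ ?_
    rw [hSmem]
    have key := hcommutator c π.1
    rw [hc, ← hz3 _ (hμA π.1), sub_self] at key
    have h := congrArg (fun T : Module.End ℂ (complexBetti X k) ↦ T (x π.2)) key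
    simpa only [LinearMap.sum_apply, LinearMap.smul_apply, LinearMap.zero_apply] using h
  -- hence `c` is a combination of RATIONAL common solutions
  have hrat := descent_ratSpanned_finset_inf Finset.univ S hSrat hcS
  rw [Submodule.mem_span_set'] at hrat
  obtain ⟨I, lam, g, hsum⟩ := hrat
  have hg : ∀ i, (g i : Fin P → ℂ) ∈ (Finset.univ : Finset (Fin P × Fin Q)).inf S ∧
      ∃ q : Fin P → ℚ, (g i : Fin P → ℂ) = fun a ↦ (q a : ℂ) := fun i ↦ (g i).2
  choose q hq using fun i ↦ (hg i).2
  refine ⟨I, fun i ↦ ∑ a, ((q i a : ℚ) : ℂ) • μ a, lam, ?_, ?_, ?_, ?_⟩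
  · intro i
    exact Subalgebra.sum_mem _ fun a _ ↦ Subalgebra.smul_mem _ (hμA a) _
  · -- centrality: the rational solution commutes with every `μ b`, hence with their span `𝓗`
    intro i T hT
    have hcommb : ∀ b, (∑ a, ((q i a : ℚ) : ℂ) • μ a) * μ b = μ b * ∑ a, ((q i a : ℚ) : ℂ) • μ a := by
      intro b
      have hΔ : ∑ a, ((q i a : ℚ) : ℂ) • (μ a * μ b - μ b * μ a) = 0 := by
        refine LinearMap.ext_on_range hxspan fun d ↦ ?_
        have hmem := (Submodule.mem_finsetInf.1 (hg i).1) (b, d) (Finset.mem_univ _)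
        rw [hSmem, hq i] at hmem
        simpa only [LinearMap.sum_apply, LinearMap.smul_apply, LinearMap.zero_apply] using hmem
      rw [hcommutator] at hΔ
      exact sub_eq_zero.1 hΔ
    have hTspan : T ∈ Submodule.span ℂ (Set.range μ) := by
      rw [hμspan]; exact hT
    obtain ⟨t, ht⟩ := (Submodule.mem_span_range_iff_exists_fun ℂ).1 hTspan
    rw [← ht, Finset.sum_mul, Finset.mul_sum]
    refine Finset.sum_congr rfl fun b _ ↦ ?_
    rw [smul_mul_assoc, mul_smul_comm, hcommb b]
  · intro i
    exact descent_rp_sum_smul _ (fun a ↦ hμrp a) (q i)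
  · -- `z = Σ_i lam_i • r_i`
    have hca : ∀ a, c a = ∑ i, lam i * ((q i a : ℚ) : ℂ) := by
      intro a
      have h := congrArg (fun f : Fin P → ℂ ↦ f a) hsum
      simp only [Finset.sum_apply, Pi.smul_apply, smul_eq_mul] at h
      rw [← h]
      refine Finset.sum_congr rfl fun i _ ↦ ?_
      rw [hq i]
    rw [← hc]
    simp_rw [hca, Finset.sum_smul, mul_smul, Finset.smul_sum]
    exact Finset.sum_comm


/-- **Registered stub `stub_centreDescent` (line `middle-involution-purity`, reshape R2) — ℚ-DESCENT OF
THE CENTRE of the Hecke algebra**, in closed `∀`-form: every central element of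
`𝓗 = Algebra.adjoin ℂ (range T_g)` on `Hᵏ(X(ℂ); ℂ)` (`X` smooth projective, carrying a datum `D`) is
a ℂ-combination of rational-preserving central elements of `𝓗` (`descent_center`).
[cite: BergeronMillsonMoeglin2016Balls, Part 2 §1.9] -/
theorem stub_centreDescent :
    ∀ (n : ℕ) (X : SchemeOver ℂ), IsSmoothProjective n X →
      ∀ (k p : ℕ) (D : UnitaryBallQuotientDatum p X) (z : Module.End ℂ (complexBetti X k)),
        z ∈ Algebra.adjoin ℂ (Set.range (D.heckeCorrespondenceAction k)) →
        (∀ T ∈ Algebra.adjoin ℂ (Set.range (D.heckeCorrespondenceAction k)), T * z = z * T) →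
        ∃ (I : ℕ) (r : Fin I → Module.End ℂ (complexBetti X k)) (cz : Fin I → ℂ),
          (∀ i, r i ∈ Algebra.adjoin ℂ (Set.range (D.heckeCorrespondenceAction k))) ∧
          (∀ i, ∀ T ∈ Algebra.adjoin ℂ (Set.range (D.heckeCorrespondenceAction k)), T * r i = r i * T) ∧
          (∀ i, ∀ β, IsRationalClass β → IsRationalClass (r i β)) ∧
          z = ∑ i, cz i • r i :=
  fun _ _ hX _ _ D _ hz1 hz3 ↦ descent_center hX D hz1 hz3

end Descent

end Summit.HodgeConjecture.HodgeConjecture.Cruxes.OrthogonalEnveloped.MiddleInvolutionPurity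

end

-- ops-buildfix-3 (2026-08-22, B12-4): enqueue re-land so the lane rebuilds this module from current source (its 08-16/17 hub olean predates the 08-20 ShimuraVarieties packet rename and poisons importers); no content change.
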